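import Summits.KontsevichZagierPeriods.KontsevichZagierPeriods.Theorems.LinRedNormalFormArrangementNormalFormStubRebaseSimplePosOnePosQuadChart

/-!
# Stub `stub_rebaseSimplePosOnePos` (crux `ArrangementNormalForm`, line `janus-bands`) —
part `QuadNorm`: the affine base change over the base `(x₁, x₂, y)` (`B = 2`)

`B = 2` corner calculus: the literal one-fibre datum
`[{rows(x', y) > 0, u < t < v}, R(x')/(y − ℓ₂(x')) · 1/t]` over the base `(x₁, x₂, y)`
(`glit 2 1 p L e ℓ₁ ℓ₂ 0 1 (some 0)`) is moved by the rational affine base change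
`x' = x₀ + A x''`, `y = ℓ₂(x') + τ y'`, `t = t'` (`A ∈ GL₂(ℚ)` with inverse `A⁻¹`, `τ = ±1`;
rule 2, Jacobian `|det A|`) to the literal datum with pole plane `y' = 0` (`ℓ₂ = 0`),
numerator `τ |det A| · p(x₀ + A X)`, silent factors `Lⱼ(x₀ + A X)` and rows / bounds composed
with the map (`RebasePos.normFQ`, `normLQ`, `normPQ`): `RebasePos.quadNormalize` — the
four-dimensional version of `RebasePos.cornerNormalize` (part `CornerNorm`). Uses: put a flat
point `x₀` at the origin with the pole plane at `y' = 0`, make two chosen directions of the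
silent plane the coordinate axes (far silent factors parallel to an axis, part `QuadMove`),
shear one silent coordinate along the other.

References: M. Kontsevich, D. Zagier, *Periods* (2001), §1.2, rule (2).
-/

noncomputable section

open Set MeasureTheory MvPolynomial
open Literature.NumberTheory.Transcendental Literature.ModelTheory.ExponentialFields

namespace Summit.KontsevichZagierPeriods.ArrangementNormalForm.JanusBands

namespace RebasePos

open SeparatePos

section QuadNormData

variable (x₀ : Fin 2 → ℚ) (A Ai : Matrix (Fin 2) (Fin 2) ℚ) (τ : ℚ) (ℓ₂ : (Fin 2 → ℚ) × ℚ)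

/-- The affine base change `(x'', y', t) ↦ (x₀ + A x'', ℓ₂(x₀ + A x'') + τ y', t)`. -/
def normMapQ (w : Fin (2 + 1 + 1) → ℝ) : Fin (2 + 1 + 1) → ℝ :=
  ![(x₀ 0 : ℝ) + (A 0 0 : ℝ) * w 0 + (A 0 1 : ℝ) * w 1,
    (x₀ 1 : ℝ) + (A 1 0 : ℝ) * w 0 + (A 1 1 : ℝ) * w 1,
    (ℓ₂.1 0 : ℝ) * ((x₀ 0 : ℝ) + (A 0 0 : ℝ) * w 0 + (A 0 1 : ℝ) * w 1) +
      (ℓ₂.1 1 : ℝ) * ((x₀ 1 : ℝ) + (A 1 0 : ℝ) * w 0 + (A 1 1 : ℝ) * w 1) + (ℓ₂.2 : ℝ) + (τ : ℝ) * w 2,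
    w 3]

/-- Its inverse `(x', y, t) ↦ (A⁻¹ (x' − x₀), τ (y − ℓ₂(x')), t)` (for `τ² = 1`). -/
def normInvQ (z : Fin (2 + 1 + 1) → ℝ) : Fin (2 + 1 + 1) → ℝ :=
  ![(Ai 0 0 : ℝ) * (z 0 - x₀ 0) + (Ai 0 1 : ℝ) * (z 1 - x₀ 1),
    (Ai 1 0 : ℝ) * (z 0 - x₀ 0) + (Ai 1 1 : ℝ) * (z 1 - x₀ 1),
    (τ : ℝ) * (z 2 - ((ℓ₂.1 0 : ℝ) * z 0 + (ℓ₂.1 1 : ℝ) * z 1 + (ℓ₂.2 : ℝ))), z 3]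

/-- A full-base affine form composed with `normMapQ`. -/
def normFQ (c : (Fin (2 + 1) → ℚ) × ℚ) : (Fin (2 + 1) → ℚ) × ℚ :=
  (![(c.1 0 + c.1 2 * ℓ₂.1 0) * A 0 0 + (c.1 1 + c.1 2 * ℓ₂.1 1) * A 1 0,
     (c.1 0 + c.1 2 * ℓ₂.1 0) * A 0 1 + (c.1 1 + c.1 2 * ℓ₂.1 1) * A 1 1,
     c.1 2 * τ],
   (c.1 0 + c.1 2 * ℓ₂.1 0) * x₀ 0 + (c.1 1 + c.1 2 * ℓ₂.1 1) * x₀ 1 + c.1 2 * ℓ₂.2 + c.2)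

/-- A silent affine form composed with `normMapQ`. -/
def normLQ (d : (Fin 2 → ℚ) × ℚ) : (Fin 2 → ℚ) × ℚ :=
  (![d.1 0 * A 0 0 + d.1 1 * A 1 0, d.1 0 * A 0 1 + d.1 1 * A 1 1], d.1 0 * x₀ 0 + d.1 1 * x₀ 1 + d.2)

/-- The numerator after `normMapQ`: `τ |det A| · p(x₀ + A X)`. -/
def normPQ (p : MvPolynomial (Fin 2) ℚ) : MvPolynomial (Fin 2) ℚ :=
  MvPolynomial.C (τ * |A.det|) *
    MvPolynomial.bind₁ (fun i : Fin 2 => MvPolynomial.C (x₀ i) + MvPolynomial.C (A i 0) * X 0 +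
      MvPolynomial.C (A i 1) * X 1) p

/-- The linear part of `normMapQ`. -/
def normMatQ : Matrix (Fin (2 + 1 + 1)) (Fin (2 + 1 + 1)) ℝ :=
  !![(A 0 0 : ℝ), (A 0 1 : ℝ), 0, 0;
     (A 1 0 : ℝ), (A 1 1 : ℝ), 0, 0;
     (ℓ₂.1 0 : ℝ) * A 0 0 + (ℓ₂.1 1 : ℝ) * A 1 0, (ℓ₂.1 0 : ℝ) * A 0 1 + (ℓ₂.1 1 : ℝ) * A 1 1, (τ : ℝ), 0;
     0, 0, 0, 1]

/-- The linear part of `normMapQ` as a continuous linear map. -/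
def normLinQ : (Fin (2 + 1 + 1) → ℝ) →L[ℝ] (Fin (2 + 1 + 1) → ℝ) :=
  LinearMap.toContinuousLinearMap (Matrix.toLin' (normMatQ A τ ℓ₂))

/-- `normMapQ` as a polynomial map. -/
def normPolyQ : Fin (2 + 1 + 1) → MvPolynomial (Fin (2 + 1 + 1)) ℚ :=
  ![MvPolynomial.C (x₀ 0) + MvPolynomial.C (A 0 0) * X 0 + MvPolynomial.C (A 0 1) * X 1,
    MvPolynomial.C (x₀ 1) + MvPolynomial.C (A 1 0) * X 0 + MvPolynomial.C (A 1 1) * X 1,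
    MvPolynomial.C (ℓ₂.1 0) * (MvPolynomial.C (x₀ 0) + MvPolynomial.C (A 0 0) * X 0 + MvPolynomial.C (A 0 1) * X 1) +
      MvPolynomial.C (ℓ₂.1 1) * (MvPolynomial.C (x₀ 1) + MvPolynomial.C (A 1 0) * X 0 + MvPolynomial.C (A 1 1) * X 1) +
      MvPolynomial.C ℓ₂.2 + MvPolynomial.C τ * X 2,
    X 3]

/-- `normMapQ` on the `x₁`-slot. -/
@[simp] theorem normMapQ_zero (w : Fin (2 + 1 + 1) → ℝ) :
    normMapQ x₀ A τ ℓ₂ w 0 = (x₀ 0 : ℝ) + (A 0 0 : ℝ) * w 0 + (A 0 1 : ℝ) * w 1 := rfl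

/-- `normMapQ` on the `x₂`-slot. -/
@[simp] theorem normMapQ_one (w : Fin (2 + 1 + 1) → ℝ) :
    normMapQ x₀ A τ ℓ₂ w 1 = (x₀ 1 : ℝ) + (A 1 0 : ℝ) * w 0 + (A 1 1 : ℝ) * w 1 := rfl

/-- `normMapQ` on the `y`-slot. -/
@[simp] theorem normMapQ_two (w : Fin (2 + 1 + 1) → ℝ) :
    normMapQ x₀ A τ ℓ₂ w 2 = (ℓ₂.1 0 : ℝ) * ((x₀ 0 : ℝ) + (A 0 0 : ℝ) * w 0 + (A 0 1 : ℝ) * w 1) +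
      (ℓ₂.1 1 : ℝ) * ((x₀ 1 : ℝ) + (A 1 0 : ℝ) * w 0 + (A 1 1 : ℝ) * w 1) + (ℓ₂.2 : ℝ) + (τ : ℝ) * w 2 := rfl

/-- `normMapQ` on the `t`-slot. -/
@[simp] theorem normMapQ_three (w : Fin (2 + 1 + 1) → ℝ) : normMapQ x₀ A τ ℓ₂ w 3 = w 3 := rfl

/-- **Key identity**: forms compose with `normMapQ` via `normFQ`. -/
theorem affF_normFQ (c : (Fin (2 + 1) → ℚ) × ℚ) (w : Fin (2 + 1 + 1) → ℝ) :
    affF 2 1 (normFQ x₀ A τ ℓ₂ c) w = affF 2 1 c (normMapQ x₀ A τ ℓ₂ w) := by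
  simp only [affF_three, normFQ, normMapQ_zero, normMapQ_one, normMapQ_two, Matrix.cons_val_zero,
    Matrix.cons_val_one, Matrix.cons_val]
  push_cast
  ring

/-- Silent forms compose with `normMapQ` via `normLQ`. -/
theorem affB_normLQ (d : (Fin 2 → ℚ) × ℚ) (w : Fin (2 + 1 + 1) → ℝ) :
    affB 2 1 (normLQ x₀ A d) w = affB 2 1 d (normMapQ x₀ A τ ℓ₂ w) := by
  simp only [affB_three, normLQ, normMapQ_zero, normMapQ_one, Matrix.cons_val_zero, Matrix.cons_val_one]
  push_cast
  ring

/-- The numerator composes with `normMapQ` via `normPQ`. -/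
theorem aeval_normPQ (p : MvPolynomial (Fin 2) ℚ) (w : Fin (2 + 1 + 1) → ℝ) :
    MvPolynomial.aeval (fun i : Fin 2 => w (Fin.castSucc (Fin.castSucc i))) (normPQ x₀ A τ p) =
      (τ : ℝ) * |(A.det : ℝ)| *
        MvPolynomial.aeval (fun i : Fin 2 => normMapQ x₀ A τ ℓ₂ w (Fin.castSucc (Fin.castSucc i))) p := by
  have hF : (fun i : Fin 2 => MvPolynomial.aeval (fun i : Fin 2 => w (Fin.castSucc (Fin.castSucc i)))
      (MvPolynomial.C (x₀ i) + MvPolynomial.C (A i 0) * X 0 + MvPolynomial.C (A i 1) * X 1 : MvPolynomial (Fin 2) ℚ)) =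
      fun i => normMapQ x₀ A τ ℓ₂ w (Fin.castSucc (Fin.castSucc i)) := by
    funext i
    fin_cases i <;> simp [normMapQ]
  rw [normPQ, map_mul, MvPolynomial.aeval_C, MvPolynomial.aeval_bind₁, eq_ratCast, hF]
  push_cast
  ring

/-- The `y`-coefficient of `normFQ c` is `τ` times that of `c`. -/
theorem normFQ_last (c : (Fin (2 + 1) → ℚ) × ℚ) : (normFQ x₀ A τ ℓ₂ c).1 (Fin.last 2) = c.1 (Fin.last 2) * τ := by
  simp [normFQ]

/-- `normFQ` is additive. -/
theorem normFQ_sub (c c' : (Fin (2 + 1) → ℚ) × ℚ) :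
    normFQ x₀ A τ ℓ₂ (c - c') = normFQ x₀ A τ ℓ₂ c - normFQ x₀ A τ ℓ₂ c' := by
  refine Prod.ext (funext fun i => ?_) ?_
  · fin_cases i <;> simp [normFQ] <;> ring
  · simp [normFQ]; ring

/-- `normFQ` is homogeneous. -/
theorem normFQ_smul (q : ℚ) (c : (Fin (2 + 1) → ℚ) × ℚ) :
    normFQ x₀ A τ ℓ₂ (q • c) = q • normFQ x₀ A τ ℓ₂ c := by
  refine Prod.ext (funext fun i => ?_) ?_
  · fin_cases i <;> simp [normFQ] <;> ring
  · simp [normFQ]; ring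

end QuadNormData

section QuadNormCalc

variable (x₀ : Fin 2 → ℚ) (A Ai : Matrix (Fin 2) (Fin 2) ℚ) (τ : ℚ) (ℓ₂ : (Fin 2 → ℚ) × ℚ)

/-- `normLinQ` in coordinates. -/
theorem normLinQ_apply (v : Fin (2 + 1 + 1) → ℝ) :
    normLinQ A τ ℓ₂ v = ![(A 0 0 : ℝ) * v 0 + (A 0 1 : ℝ) * v 1, (A 1 0 : ℝ) * v 0 + (A 1 1 : ℝ) * v 1,
      ((ℓ₂.1 0 : ℝ) * A 0 0 + (ℓ₂.1 1 : ℝ) * A 1 0) * v 0 + ((ℓ₂.1 0 : ℝ) * A 0 1 + (ℓ₂.1 1 : ℝ) * A 1 1) * v 1 +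
        (τ : ℝ) * v 2, v 3] := by
  rw [normLinQ, LinearMap.coe_toContinuousLinearMap', Matrix.toLin'_apply]
  funext l
  fin_cases l <;> simp [normMatQ, Matrix.mulVec, dotProduct, Fin.sum_univ_four]

/-- `normMapQ` is the affine map `normLinQ + const`. -/
theorem normMapQ_eq (w : Fin (2 + 1 + 1) → ℝ) :
    normMapQ x₀ A τ ℓ₂ w = normLinQ A τ ℓ₂ w +
      ![(x₀ 0 : ℝ), (x₀ 1 : ℝ), (ℓ₂.1 0 : ℝ) * x₀ 0 + (ℓ₂.1 1 : ℝ) * x₀ 1 + ℓ₂.2, 0] := by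
  rw [normLinQ_apply]
  funext l
  fin_cases l <;> simp [normMapQ] <;> ring

/-- `normMapQ` has derivative `normLinQ`. -/
theorem hasFDerivAt_normMapQ (w : Fin (2 + 1 + 1) → ℝ) :
    HasFDerivAt (normMapQ x₀ A τ ℓ₂) (normLinQ A τ ℓ₂) w := by
  have h : normMapQ x₀ A τ ℓ₂ = fun w => normLinQ A τ ℓ₂ w +
      ![(x₀ 0 : ℝ), (x₀ 1 : ℝ), (ℓ₂.1 0 : ℝ) * x₀ 0 + (ℓ₂.1 1 : ℝ) * x₀ 1 + ℓ₂.2, 0] :=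
    funext (normMapQ_eq x₀ A τ ℓ₂)
  rw [h]
  exact (normLinQ A τ ℓ₂).hasFDerivAt.add_const _

/-- The Jacobian determinant of `normMapQ` is `det A · τ`. -/
theorem normLinQ_det : (normLinQ A τ ℓ₂).det = (A.det : ℝ) * τ := by
  rw [normLinQ, ContinuousLinearMap.det, LinearMap.coe_toContinuousLinearMap, LinearMap.det_toLin',
    Matrix.det_succ_row_zero, Matrix.det_fin_two]
  simp [normMatQ, Fin.sum_univ_succ, Matrix.det_fin_three, Matrix.submatrix_apply, Fin.succAbove]
  ring

/-- `normInvQ ∘ normMapQ = id`. -/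
theorem normInvQ_normMapQ (hA : Ai * A = 1) (hτ : τ * τ = 1) (w : Fin (2 + 1 + 1) → ℝ) :
    normInvQ x₀ Ai τ ℓ₂ (normMapQ x₀ A τ ℓ₂ w) = w := by
  have hτ' : (τ : ℝ) * τ = 1 := by exact_mod_cast hτ
  have h00 : (Ai 0 0 : ℝ) * A 0 0 + Ai 0 1 * A 1 0 = 1 := by
    have := congrFun (congrFun hA 0) 0; simp [Matrix.mul_apply, Fin.sum_univ_two] at this; exact_mod_cast this
  have h01 : (Ai 0 0 : ℝ) * A 0 1 + Ai 0 1 * A 1 1 = 0 := by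
    have := congrFun (congrFun hA 0) 1; simp [Matrix.mul_apply, Fin.sum_univ_two] at this; exact_mod_cast this
  have h10 : (Ai 1 0 : ℝ) * A 0 0 + Ai 1 1 * A 1 0 = 0 := by
    have := congrFun (congrFun hA 1) 0; simp [Matrix.mul_apply, Fin.sum_univ_two] at this; exact_mod_cast this
  have h11 : (Ai 1 0 : ℝ) * A 0 1 + Ai 1 1 * A 1 1 = 1 := by
    have := congrFun (congrFun hA 1) 1; simp [Matrix.mul_apply, Fin.sum_univ_two] at this; exact_mod_cast this
  funext l
  fin_cases l
  · simp only [normInvQ, normMapQ_zero, normMapQ_one, Fin.zero_eta, Matrix.cons_val_zero]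
    linear_combination (w 0) * h00 + (w 1) * h01
  · simp only [normInvQ, normMapQ_zero, normMapQ_one, Fin.mk_one, Matrix.cons_val_one, Matrix.cons_val_zero]
    linear_combination (w 0) * h10 + (w 1) * h11
  · simp only [normInvQ, normMapQ_zero, normMapQ_one, normMapQ_two, Fin.reduceFinMk, Matrix.cons_val]
    linear_combination (w 2) * hτ'
  · rfl

/-- `normMapQ ∘ normInvQ = id`. -/
theorem normMapQ_normInvQ (hA : A * Ai = 1) (hτ : τ * τ = 1) (z : Fin (2 + 1 + 1) → ℝ) :
    normMapQ x₀ A τ ℓ₂ (normInvQ x₀ Ai τ ℓ₂ z) = z := by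
  have hτ' : (τ : ℝ) * τ = 1 := by exact_mod_cast hτ
  have h00 : (A 0 0 : ℝ) * Ai 0 0 + A 0 1 * Ai 1 0 = 1 := by
    have := congrFun (congrFun hA 0) 0; simp [Matrix.mul_apply, Fin.sum_univ_two] at this; exact_mod_cast this
  have h01 : (A 0 0 : ℝ) * Ai 0 1 + A 0 1 * Ai 1 1 = 0 := by
    have := congrFun (congrFun hA 0) 1; simp [Matrix.mul_apply, Fin.sum_univ_two] at this; exact_mod_cast this
  have h10 : (A 1 0 : ℝ) * Ai 0 0 + A 1 1 * Ai 1 0 = 0 := by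
    have := congrFun (congrFun hA 1) 0; simp [Matrix.mul_apply, Fin.sum_univ_two] at this; exact_mod_cast this
  have h11 : (A 1 0 : ℝ) * Ai 0 1 + A 1 1 * Ai 1 1 = 1 := by
    have := congrFun (congrFun hA 1) 1; simp [Matrix.mul_apply, Fin.sum_univ_two] at this; exact_mod_cast this
  funext l
  fin_cases l
  · simp only [normMapQ, normInvQ, Fin.zero_eta, Matrix.cons_val_zero, Matrix.cons_val_one]
    linear_combination (z 0 - x₀ 0) * h00 + (z 1 - x₀ 1) * h01
  · simp only [normMapQ, normInvQ, Fin.mk_one, Matrix.cons_val_one, Matrix.cons_val_zero]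
    linear_combination (z 0 - x₀ 0) * h10 + (z 1 - x₀ 1) * h11
  · simp only [normMapQ, normInvQ, Fin.reduceFinMk, Matrix.cons_val, Matrix.cons_val_zero, Matrix.cons_val_one]
    linear_combination (z 2 - ((ℓ₂.1 0 : ℝ) * z 0 + (ℓ₂.1 1 : ℝ) * z 1 + (ℓ₂.2 : ℝ))) * hτ' +
      (ℓ₂.1 0 : ℝ) * ((z 0 - x₀ 0) * h00 + (z 1 - x₀ 1) * h01) +
      (ℓ₂.1 1 : ℝ) * ((z 0 - x₀ 0) * h10 + (z 1 - x₀ 1) * h11)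
  · rfl

/-- `normInvQ` is continuous. -/
theorem continuous_normInvQ : Continuous (normInvQ x₀ Ai τ ℓ₂) := by
  refine continuous_pi fun l => ?_
  fin_cases l <;> simp only [normInvQ, Fin.zero_eta, Fin.mk_one, Fin.reduceFinMk, Matrix.cons_val_zero,
    Matrix.cons_val_one, Matrix.cons_val] <;> fun_prop

/-- `normPolyQ` evaluates to `normMapQ`. -/
theorem aeval_normPolyQ (w : Fin (2 + 1 + 1) → ℝ) :
    (fun l => MvPolynomial.aeval w (normPolyQ x₀ A τ ℓ₂ l)) = normMapQ x₀ A τ ℓ₂ w := by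
  funext l
  fin_cases l <;> simp [normPolyQ, normMapQ]

end QuadNormCalc

section QuadNormMove

variable (x₀ : Fin 2 → ℚ) (A Ai : Matrix (Fin 2) (Fin 2) ℚ) (τ : ℚ) (ℓ₂ : (Fin 2 → ℚ) × ℚ) {m m' : ℕ}

/-- **The affine base change over `(x₁, x₂, y)`** (rule 2, Jacobian `|det A|`). A literal
one-fibre datum with base pole `y = ℓ₂(x')` and letter `0` is moved by `x' = x₀ + A x''`,
`y = ℓ₂(x') + τ y'` (`A A⁻¹ = A⁻¹ A = 1`, `τ² = 1`) to the literal datum with base pole `y' = 0`,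
numerator `τ |det A| p(x₀ + A X)`, silent factors `Lⱼ(x₀ + A X)` and rows / bounds `normFQ`. -/
theorem quadNormalize (hA : A * Ai = 1) (hA' : Ai * A = 1) (hτ : τ * τ = 1) (s : KZ.IntegralRep (2 + 1 + 1))
    (M : Fin m' → (Fin (2 + 1) → ℚ) × ℚ) (L : Fin m → (Fin 2 → ℚ) × ℚ) (e : Fin m → ℕ)
    (p : MvPolynomial (Fin 2) ℚ) (ℓ₁ : (Fin 2 → ℚ) × ℚ) (u v : (Fin (2 + 1) → ℚ) × ℚ)
    (hbd : Bornology.IsBounded s.domain)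
    (hdom : s.domain = gDom 2 1 m' M (fun _ => Sum.inr u) (fun _ => Sum.inr v))
    (hint : EqOn s.integrand (glit 2 1 p L e ℓ₁ ℓ₂ 0 1 (fun _ => some 0)) s.domain) :
    ∃ s' : KZ.IntegralRep (2 + 1 + 1), Bornology.IsBounded s'.domain ∧
      s'.domain = gDom 2 1 m' (fun j => normFQ x₀ A τ ℓ₂ (M j)) (fun _ => Sum.inr (normFQ x₀ A τ ℓ₂ u))
        (fun _ => Sum.inr (normFQ x₀ A τ ℓ₂ v)) ∧
      EqOn s'.integrand (glit 2 1 (normPQ x₀ A τ p) (fun j => normLQ x₀ A (L j)) e ℓ₁ 0 0 1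
        (fun _ => some 0)) s'.domain ∧
      (∀ w, w ∈ s'.domain ↔ normMapQ x₀ A τ ℓ₂ w ∈ s.domain) ∧
      KZ.of s - KZ.of s' ∈ KZ.relations := by
  set R := gDom 2 1 m' (fun j => normFQ x₀ A τ ℓ₂ (M j)) (fun _ => Sum.inr (normFQ x₀ A τ ℓ₂ u))
    (fun _ => Sum.inr (normFQ x₀ A τ ℓ₂ v)) with hR
  have hτ' : (τ : ℝ) * τ = 1 := by exact_mod_cast hτ
  -- membership
  have hΨdom : ∀ w, w ∈ R ↔ normMapQ x₀ A τ ℓ₂ w ∈ s.domain := fun w => by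
    rw [hR, mem_gDom_one, hdom, mem_gDom_one]
    simp only [affF_normFQ, jt_eq, normMapQ_three]
  have himg : normMapQ x₀ A τ ℓ₂ '' R = s.domain := by
    ext z
    constructor
    · rintro ⟨w, hw, rfl⟩
      exact (hΨdom w).1 hw
    · intro hz
      exact ⟨normInvQ x₀ Ai τ ℓ₂ z, (hΨdom _).2 (by rw [normMapQ_normInvQ x₀ A Ai τ ℓ₂ hA hτ]; exact hz),
        normMapQ_normInvQ x₀ A Ai τ ℓ₂ hA hτ z⟩
  have hinj : InjOn (normMapQ x₀ A τ ℓ₂) R := fun w _ w' _ h => by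
    rw [← normInvQ_normMapQ x₀ A Ai τ ℓ₂ hA' hτ w, h, normInvQ_normMapQ x₀ A Ai τ ℓ₂ hA' hτ]
  -- the integrand identity
  have hdet : |(normLinQ A τ ℓ₂).det| = |(A.det : ℝ)| := by
    have h2 : |(τ : ℝ)| = 1 :=
      (pow_eq_one_iff_of_nonneg (abs_nonneg _) two_ne_zero).1 (by rw [pow_two, ← abs_mul, hτ', abs_one])
    rw [normLinQ_det, abs_mul, h2, mul_one]
  have hf : ∀ w ∈ R, glit 2 1 (normPQ x₀ A τ p) (fun j => normLQ x₀ A (L j)) e ℓ₁ 0 0 1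
      (fun _ => some 0) w = s.integrand (normMapQ x₀ A τ ℓ₂ w) * |(normLinQ A τ ℓ₂).det| := by
    intro w hw
    have hτinv : (τ : ℝ)⁻¹ = τ := inv_eq_of_mul_eq_one_left hτ'
    rw [hint ((hΨdom w).1 hw), hdet, glit_three, glit_three, aeval_normPQ x₀ A τ ℓ₂]
    simp only [affB_normLQ x₀ A τ ℓ₂, normMapQ_two, normMapQ_three, affB_three, normMapQ_zero, normMapQ_one,
      Prod.fst_zero, Pi.zero_apply, Prod.snd_zero, Rat.cast_zero, zero_mul, add_zero, sub_zero]
    have key : (ℓ₂.1 0 : ℝ) * ((x₀ 0 : ℝ) + (A 0 0 : ℝ) * w 0 + (A 0 1 : ℝ) * w 1) +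
        (ℓ₂.1 1 : ℝ) * ((x₀ 1 : ℝ) + (A 1 0 : ℝ) * w 0 + (A 1 1 : ℝ) * w 1) + (ℓ₂.2 : ℝ) + (τ : ℝ) * w 2 -
        ((ℓ₂.1 0 : ℝ) * ((x₀ 0 : ℝ) + (A 0 0 : ℝ) * w 0 + (A 0 1 : ℝ) * w 1) +
          (ℓ₂.1 1 : ℝ) * ((x₀ 1 : ℝ) + (A 1 0 : ℝ) * w 0 + (A 1 1 : ℝ) * w 1) + (ℓ₂.2 : ℝ)) = τ * w 2 := by ring
    rw [key, one_div ((τ : ℝ) * w 2), mul_inv_rev, hτinv]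
    ring
  have hRsa : IsSemialgebraic ℚ R := isSemialgebraic_gDom _ _ _ _
  have hsa : IsSemialgebraicMapOn ℚ R (normMapQ x₀ A τ ℓ₂) :=
    (isSemialgebraicMapOn_aeval hRsa (normPolyQ x₀ A τ ℓ₂)).congr fun w _ => aeval_normPolyQ x₀ A τ ℓ₂ w
  obtain ⟨s', hd', hi', hrel⟩ := RebaseZero.cov_pull s hRsa (normMapQ x₀ A τ ℓ₂) (fun _ => normLinQ A τ ℓ₂) hsa
    (fun w _ => (hasFDerivAt_normMapQ x₀ A τ ℓ₂ w).hasFDerivWithinAt) hinj himg _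
    (isSemialgebraicFunOn_glit hRsa _ _ _ _ _ _ _ _) hf
  refine ⟨s', ?_, hd', fun w _ => by rw [hi'], fun w => by rw [hd']; exact hΨdom w, hrel⟩
  rw [hd']
  refine ((hbd.isCompact_closure.image (continuous_normInvQ x₀ Ai τ ℓ₂)).isBounded).subset fun w hw => ?_
  exact ⟨normMapQ x₀ A τ ℓ₂ w, subset_closure ((hΨdom w).1 hw), normInvQ_normMapQ x₀ A Ai τ ℓ₂ hA' hτ w⟩

end QuadNormMove

end RebasePos

/-- **Registered part of `stub_rebaseSimplePosOnePos` (line `janus-bands`, `B = 2` corner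
calculus): the affine base change over `(x₁, x₂, y)`** (`RebasePos.quadNormalize`, rule 2 with
Jacobian `|det A|`): a literal one-fibre datum over the base `(x₁, x₂, y)` with base pole
`y = ℓ₂(x')` and letter `0` is congruent modulo `KZ.relations` to the literal datum obtained by
`x' = x₀ + A x''`, `y = ℓ₂(x') + τ y'` (`A ∈ GL₂(ℚ)`, `τ² = 1`), whose base pole is `y' = 0`. -/
theorem rebaseSimplePos_quadNormalize (x₀ : Fin 2 → ℚ) (A Ai : Matrix (Fin 2) (Fin 2) ℚ) (τ : ℚ) (ℓ₂ : (Fin 2 → ℚ) × ℚ) (m m' : ℕ) (hA : A * Ai = 1) (hA' : Ai * A = 1) (hτ : τ * τ = 1) (s : KZ.IntegralRep (2 + 1 + 1)) (M : Fin m' → (Fin (2 + 1) → ℚ) × ℚ) (L : Fin m → (Fin 2 → ℚ) × ℚ) (e : Fin m → ℕ) (p : MvPolynomial (Fin 2) ℚ) (ℓ₁ : (Fin 2 → ℚ) × ℚ) (u v : (Fin (2 + 1) → ℚ) × ℚ) (hbd : Bornology.IsBounded s.domain) (hdom : s.domain = SeparatePos.gDom 2 1 m' M (fun _ => Sum.inr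 u) (fun _ => Sum.inr v)) (hint : Set.EqOn s.integrand (RebasePos.glit 2 1 p L e ℓ₁ ℓ₂ 0 1 (fun _ => some 0)) s.domain) : ∃ s' : KZ.IntegralRep (2 + 1 + 1), Bornology.IsBounded s'.domain ∧ s'.domain = SeparatePos.gDom 2 1 m' (fun j => RebasePos.normFQ x₀ A τ ℓ₂ (M j)) (fun _ => Sum.inr (RebasePos.normFQ x₀ A τ ℓ₂ u)) (fun _ => Sum.inr (RebasePos.normFQ x₀ A τ ℓ₂ v)) ∧ Set.EqOn s'.integrand (RebasePos.glit 2 1 (RebasePos.normPQ x₀ A τ p) (fun j => RebasePos.normLQ x₀ A (L j)) e ℓ₁ 0 0 1 (fun _ => some 0)) s'.domain ∧ (∀ w, w ∈ s'.domain ↔ RebasePos.normMapQ x₀ A τ ℓ₂ w ∈ s.domain) ∧ KZ.of s - KZ.of s' ∈ KZ.relations :=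
  RebasePos.quadNormalize x₀ A Ai τ ℓ₂ hA hA' hτ s M L e p ℓ₁ u v hbd hdom hint

end Summit.KontsevichZagierPeriods.ArrangementNormalForm.JanusBands
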